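import Summits.FinalStateConjecture.FinalStateConjecture.Theorems.NearExtremalKappaCapture.Negative.ExtremalGerm

/-!
# Strategist evidence K1 (crux stmt-FinalStateConjecture-10606 `NearExtremalKappaCapture`):
# the CONJECTURE-GRADE key — Lipschitz capture at the geometric basin order `γ = 1`

Not a line, not an item: a typed OPTION for the human's ruling (STRATEGY-CENSUS.md §5, door K1).
`NearExtremalLipschitzCapture` is the minimal strengthening of the crux through which the nearest
expert conjecture feeds it: Angelopoulos–Kehle–Unger arXiv:2603.10378 Conj. 1 (vacuum Kerr included,
p. 12: uniform neighbourhood of the extremal threshold, Kerr universality of black-hole end states,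
`C¹` isologous foliation) read in a topology in which the Kerr family is continuous (`δ < 1/2`) with a
LIPSCHITZ final-parameter map gives exactly `LinearCaptureWith s δ k 1 a₁` (basin `cχ¹` — the order-one
shrinkage is forced by the member / truncation traps of `Negative/ThresholdTraps`, `Negative/TruncationTraps`,
so no uniform basin can be asked in these norms — and modulus `C·dist`). The Lean edge to the crux is the
landed `captureWith_of_linear` (p77058) at `(γ, p) = (1, −1/2)`.

If the human rules that rank 2 of route PhaseMixingCapture becomes a conditional, the tenure planner files
`NearExtremalLipschitzCapture` as an `@[conjecture]` statement item (Summits/…/Theorems) and re-glues with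
`near_of_lipschitzCapture`; nothing here is asserted.
-/

noncomputable section

set_option linter.dupNamespace false

namespace Summit.FinalStateConjecture.FinalStateConjecture.Cruxes.NearExtremalKappaCapture.Strategist

open Literature.Geometry.Lorentzian
open Summit.FinalStateConjecture.FinalStateConjecture.Theorems.NearExtremalKappaCapture.Negative

/-- **Conjecture-grade key K1.** κ-explicit capture of the near-extremal spins with the basin exponent
PINNED to the geometric order one and a LIPSCHITZ (κ-free) final-parameter modulus: there are `(s, δ, k)`
and `a₁ < 1` such that for every `M > 0` some `c > 0`, `C` give, for all `a₁M ≤ |a| < M` and all vacuum data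
`D` on `Kerr.slice a M` within `dist_{s,δ} < c·(1 − (a/M)²)` of `Kerr.data M a M`: every MGHD is far-complete,
`C^k`-converges to a sub-extremal Kerr `(M', a')`, and `|M' − M| + |a' − a| ≤ C·dist`. This is what AKU
arXiv:2603.10378 Conj. 1 (+ Lipschitz final parameters) asserts for vacuum Kerr in the tree's Cauchy
vocabulary; it is STRONGER than the crux (conjecture grade, not a fact). -/
def NearExtremalLipschitzCapture : Prop :=
  ∀ [Kerr.Facts] [Kerr.SliceFacts], ∃ (s : ℕ) (δ : ℝ) (k : ℕ) (a₁ : ℝ), a₁ < 1 ∧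
    LinearCaptureWith s δ k 1 a₁

/-- **The bridge**: K1 implies the crux, with exponent vector `(s, δ, k, γ, p, a₁) = (s, δ, k, 1, −1/2, a₁)`
(landed `captureWith_of_linear`, then `near_iff`). -/
theorem near_of_lipschitzCapture (h : NearExtremalLipschitzCapture) :
    Theses.PhaseMixingCapture.NearExtremalKappaCapture := by
  refine near_iff.mpr ?_
  intro hF hS
  obtain ⟨s, δ, k, a₁, ha₁, hlin⟩ := @h hF hS
  exact ⟨s, δ, k, 1, -(1 / 2), a₁, ha₁, captureWith_of_linear hlin⟩

end Summit.FinalStateConjecture.FinalStateConjecture.Cruxes.NearExtremalKappaCapture.Strategist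

end
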